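import Mathlib
import HarnessLib

/-!
# Injectivity is a Borel condition on `C(Ω, ℂ)` (stub T2b of crux `RemovableLimit`)

Route `SAWWeldingIdentification`, crux stmt-CriticalPhenomena-4503 `RemovableLimit`, line
`registered` (skeleton v3), stub `stub_measurableSet_injective`.

Proof sketch: the off-diagonal `S = {p : Ω × Ω | p.1 ≠ p.2}` is an open subset of the locally
compact second countable space `Ω × Ω`, hence `σ`-compact, `S = ⋃ n, D n` with `D n` compact.
A map `g` is injective iff `Φ g := g ∘ fst - g ∘ snd` has no zero on each `D n`, and
`{G : C(Ω × Ω, ℂ) | MapsTo G (D n) {0}ᶜ}` is open in the compact-open topology while `Φ` is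
continuous; so the set of injective maps is a `G_δ`, in particular Borel.
-/

open MeasureTheory Filter Set Topology

namespace Summit.CriticalPhenomena.SAWScalingLimit.Theorems.RemovableLimit

/-- **Injectivity is a Borel condition.** For open `Ω ⊆ ℂ` and any Borel structure on `C(Ω, ℂ)`
(compact-open topology), `{g : C(Ω, ℂ) | g injective}` is Borel (indeed `G_δ`). [folklore] -/
theorem stub_measurableSet_injective {Ω : Set ℂ} (hΩ : IsOpen Ω)
    [MeasurableSpace C(Ω, ℂ)] [BorelSpace C(Ω, ℂ)] :
    MeasurableSet {g : C(Ω, ℂ) | Function.Injective g} := by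
  haveI : LocallyCompactSpace Ω := hΩ.locallyCompactSpace
  -- the off-diagonal of `Ω × Ω`, an open (hence `σ`-compact) subset
  have hSo : IsOpen {p : Ω × Ω | p.1 ≠ p.2} := isOpen_ne_fun continuous_fst continuous_snd
  haveI : LocallyCompactSpace {p : Ω × Ω | p.1 ≠ p.2} := hSo.locallyCompactSpace
  have hSσ : IsSigmaCompact {p : Ω × Ω | p.1 ≠ p.2} :=
    isSigmaCompact_iff_sigmaCompactSpace.mpr inferInstance
  obtain ⟨D, hDc, hDU⟩ := hSσ
  -- the continuous map `g ↦ ((x, y) ↦ g x - g y)`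
  have hΦ : Continuous fun g : C(Ω, ℂ) =>
      g.comp ContinuousMap.fst - g.comp (ContinuousMap.snd (α := Ω) (β := Ω)) :=
    (ContinuousMap.continuous_precomp _).sub (ContinuousMap.continuous_precomp _)
  have key : {g : C(Ω, ℂ) | Function.Injective g} =
      ⋂ n, (fun g : C(Ω, ℂ) => g.comp ContinuousMap.fst - g.comp ContinuousMap.snd) ⁻¹'
        {G : C(Ω × Ω, ℂ) | MapsTo G (D n) {0}ᶜ} := by
    ext g
    simp only [mem_setOf_eq, mem_iInter, mem_preimage]
    constructor
    · intro hg n p hp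
      have hpS : p ∈ {p : Ω × Ω | p.1 ≠ p.2} := hDU ▸ mem_iUnion.mpr ⟨n, hp⟩
      simpa [sub_eq_zero] using hg.ne hpS
    · intro h x y hxy
      by_contra hne
      have hxyS : (x, y) ∈ {p : Ω × Ω | p.1 ≠ p.2} := hne
      rw [← hDU] at hxyS
      obtain ⟨n, hn⟩ := mem_iUnion.mp hxyS
      exact h n hn (by simp [hxy])
  rw [key]
  exact MeasurableSet.iInter fun n =>
    ((ContinuousMap.isOpen_setOf_mapsTo (hDc n) isOpen_compl_singleton).preimage hΦ).measurableSet

end Summit.CriticalPhenomena.SAWScalingLimit.Theorems.RemovableLimit
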